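import Summits.BirchSwinnertonDyer.BirchSwinnertonDyer.Theorems.CyclotomicUntwistGNineConverse
import Summits.BirchSwinnertonDyer.BirchSwinnertonDyer.Theorems.CyclotomicUntwistPSRankOneLowerHalfAtThreeGNineCriterion
import HarnessLib

/-!
# The `(G₉)`-rows of the wild cell at `3`: `TypeGNine ↔ (ord₃ Δ_min even ∧ Δ_min/3^v ≡ 1 (mod 3))`

Support file for the crux `PSRankOneLowerHalfAtThree` (K1, `stmt-BirchSwinnertonDyer-21580`) of the
route `CyclotomicUntwist` (sub-problem `BirchSwinnertonDyer`).  On class-O6 curves at `3`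
(additive, `ord₃ j ≥ 0`, `f₃ ≠ 2`) the two row descriptions used by the route coincide:
`TypeGNine W` (good reduction over `ℚ(ζ₉)` above `3`) iff `ord₃ Δ_min` is even and
`Δ_min / 3^{ord₃ Δ_min} ≡ 1 (mod 3)` (`GNineCriterion.typeGNine_of_square_minimalDiscriminant` and
`GNineConverse.mod_three_eq_one_of_typeGNine`).  Consequently the hypotheses of K1 / K2
(`PSRankOne{Lower,Upper}HalfAtThree`) select exactly the `(G₉)`-rows, and the residual item
`WildSurjRankOneSupercuspidalAtThree` is exactly the class-O6 rows that are NOT of type `(G₉)`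
(`not_square_iff_not_typeGNine`).

References: A. Kraus, Manuscripta Math. 69 (1990), Théorème 1.
-/

set_option linter.dupNamespace false

open Summit.BirchSwinnertonDyer.Rank1Residual.Additive

namespace Summit.BirchSwinnertonDyer.BirchSwinnertonDyer.Theorems.GNineConverse

/-- **The `(G₉)`-rows of the wild cell.** For a globally minimal elliptic `W/ℚ` of class O6 at `3`:
`TypeGNine W ↔ (ord₃ Δ_min even ∧ Δ_min / 3^{ord₃ Δ_min} ≡ 1 (mod 3))`.
[cite: Kraus1990, Théorème 1 (p = 3)] -/
theorem typeGNine_iff_even_and_mod_three_eq_one (W : WeierstrassCurve ℚ) [W.IsElliptic]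
    [W.IsGloballyMinimal] (hO6 : ClassO6 W 3) :
    TypeGNine W ↔ (Even (padicValInt 3 W.minimalDiscriminantInt) ∧
      W.minimalDiscriminantInt / 3 ^ padicValInt 3 W.minimalDiscriminantInt % 3 = 1) := by
  refine ⟨fun h ↦ ⟨GNineCriterion.even_padicValInt_minimalDiscriminantInt_of_typeGNine W h,
    mod_three_eq_one_of_typeGNine W h hO6⟩, fun h ↦ ?_⟩
  obtain ⟨-, hadd, hpm, -⟩ := hO6
  exact GNineCriterion.typeGNine_of_square_minimalDiscriminant W hadd hpm h.1 h.2

/-- **The residual rows are the non-`(G₉)` rows.** For a globally minimal elliptic `W/ℚ` of class O6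
at `3`, the residual condition of `WildSurjRankOneSupercuspidalAtThree`,
`¬ (ord₃ Δ_min even ∧ Δ_min / 3^{ord₃ Δ_min} ≡ 1 (mod 3))`, is `¬ TypeGNine W`.
[cite: Kraus1990, Théorème 1 (p = 3)] -/
theorem not_square_iff_not_typeGNine (W : WeierstrassCurve ℚ) [W.IsElliptic]
    [W.IsGloballyMinimal] (hO6 : ClassO6 W 3) :
    ¬ (Even (padicValInt 3 W.minimalDiscriminantInt) ∧
      W.minimalDiscriminantInt / 3 ^ padicValInt 3 W.minimalDiscriminantInt % 3 = 1) ↔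
      ¬ TypeGNine W :=
  not_congr (typeGNine_iff_even_and_mod_three_eq_one W hO6).symm

end Summit.BirchSwinnertonDyer.BirchSwinnertonDyer.Theorems.GNineConverse
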